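import Summits.AnomalousDissipation.AnomalousDissipation.Theorems.SolenoidalFractalHomogenisationLagrangianStepCellChainEnergyFrame
import Summits.AnomalousDissipation.AnomalousDissipation.Theorems.SolenoidalFractalHomogenisationLagrangianStepCellChainModesFrame
import Summits.AnomalousDissipation.AnomalousDissipation.Theorems.SolenoidalFractalHomogenisationLagrangianStepSidebandXTailIntegral
import HarnessLib

/-!
# K1L_D `LagrangianRenormalisationStepDesign` (stmt-AnomalousDissipation-27980), registered stub `stub_D1_V0thg` (v28, ruling D28-3 (3)), port-map layer L5:
# THE TIME-INTEGRATED ENERGY OF A FINITE SET OF HIGH MODES OF THE FROZEN-FRAME WEAK SOLUTION IS `≤ ‖F‖²/(8π²·lo'c·κ)`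
# (helper; `--supports stmt-AnomalousDissipation-27980 --as helper`)

Summits-side helper file of route `SolenoidalFractalHomogenisation` (prover seat `ad-k1l-cellLawV-w1` g9; port map
`Cruxes/LagrangianRenormalisationStepDesign/Lines/onelevel-vtheta-twist-portmap.md` §3 L5, ruling D28-7).  The frozen-frame twin of `…SidebandXTailIntegral`, from
the twisted energy package `CellChain.exists_energyRep_cell_frame` (`le_on_Icc_of_ae_le` of `…CellChainSlotStepInputs` is flat, REUSED BY NAME).
Everything proved; no definitions, no named facts, no sorry.
* **`integral_sum_norm_sq_modeRepθ_le`** — for a finite `S` with `κ ≤ |k|²` on `S` (`κ > 0`), a frame with `c|k|² ≤ |G₀ᵀk|²` (`c > 0`) and a datum with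
  `∇·(G₀F) = 0` weakly: `∫_{(0,T)} Σ_{k∈S} ‖modeRepθ k t‖² dt ≤ ‖F‖²/(8π²·(lo' c)·κ)`.
At `G₀ = 1`, `c = 1` this is the flat statement.
NOT a proof of any registered stub, of the crux, or of anomalous dissipation; rung F-D1 infrastructure for the `stub_D1_V0thg` engine.
-/

set_option linter.dupNamespace false

noncomputable section

namespace Summit.AnomalousDissipation.AnomalousDissipation.Theorems.SolenoidalFractalHomogenisation.LagrangianStep.CellChain

open Set MeasureTheory Complex UnitAddTorus Filter Topology
open scoped InnerProductSpace
open Literature.Analysis Literature.Analysis.FunctionSpaces Literature.Analysis.FunctionSpaces.Torus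
open Literature.Analysis.FluidPDE Literature.Analysis.FluidPDE.Torus Literature.Analysis.FluidPDE.LatticeShear

variable {k₀ : ℕ}

/-- **Time-integrated energy of a finite set of high modes**: for `S` finite with `κ ≤ |k|²` on `S`,
`∫_{(0,T)} Σ_{k∈S} ‖modeRep k t‖² ≤ ‖F‖²/(8π²·lo'·κ)`. [cite: Temam1984, Ch. III §1 Lemma 1.2 (energy inequality)] -/
theorem integral_sum_norm_sq_modeRepθ_le (W₁ : LatticeWord k₀) (n : ℕ) {T : ℝ} (hT : 0 < T) {𝔹 : Torus.Visc4 (Fin 3)} {lo' hi' : ℝ}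
    (h𝔹 : Torus.NearIso 𝔹 lo' hi') (hlo' : 0 < lo') (G₀ : Matrix (Fin 3) (Fin 3) ℝ)
    {c : ℝ} (hc : 0 < c) (hG : ∀ k : Fin 3 → ℤ, c * freqNormSq k ≤ ∑ a, Torus.twistFreq G₀ k a ^ 2)
    {F : UnitAddTorus (Fin 3) → EuclideanSpace ℝ (Fin 3)} {u : ℝ → UnitAddTorus (Fin 3) → EuclideanSpace ℝ (Fin 3)}
    (hF : MemLp F 2 volume) (hFdiv : FunctionSpaces.Torus.IsWeaklyDivFree (Torus.distort (fun _ => G₀) F)) (hFi : Integrable F volume)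
    (h : Torus.IsWeakTensorPassiveVectorDistortedOn 0 T 𝔹 (W₁.cell n) (fun _ _ => G₀) F u) (S : Finset (Fin 3 → ℤ)) {κ : ℝ} (hκ : 0 < κ)
    (hS : ∀ k ∈ S, κ ≤ freqNormSq k) :
    ∫ t in Ioo 0 T, ∑ k ∈ S, ‖modeRepθ W₁ n 𝔹 G₀ F u k t‖ ^ 2 ≤ (∫ x, ‖F x‖ ^ 2) / (8 * Real.pi ^ 2 * (lo' * c) * κ) := by
  obtain ⟨E, Q, hE0, hEQ, hEc, _, _, hEae, hQint, hQnn, _, hQdom, hterm⟩ := exists_energyRep_cell_frame W₁ n hT h𝔹 hlo' G₀ hc hG hF hFdiv h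
  have hloc : 0 < lo' * c := mul_pos hlo' hc
  have hπ : 0 < 8 * Real.pi ^ 2 * (lo' * c) * κ := by positivity
  -- (1) `∫₀ᵀ Q ≤ ‖F‖²/2` from `E T ≥ 0`
  have hET : 0 ≤ E T := by
    have hc0 : ContinuousOn (fun _ : ℝ => (0:ℝ)) (Icc 0 T) := continuousOn_const
    have hae : ∀ᵐ t ∂(volume.restrict (Ioo 0 T)), (0:ℝ) ≤ E t := by
      filter_upwards [hEae] with t ht
      rw [ht]; positivity
    exact le_on_Icc_of_ae_le hT hc0 hEc hae T ⟨hT.le, le_rfl⟩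
  have hQT : ∫ s in (0:ℝ)..T, Q s ≤ (∫ x, ‖F x‖ ^ 2) / 2 := by
    have := hEQ T ⟨hT.le, le_rfl⟩
    linarith
  have hQT' : ∫ s in Ioo 0 T, Q s ≤ (∫ x, ‖F x‖ ^ 2) / 2 := by
    rw [← integral_Ioc_eq_integral_Ioo, ← intervalIntegral.integral_of_le hT.le]
    exact hQT
  -- (2) a.e. pointwise: `Σ_S ‖modeRep k t‖² ≤ Q t/(4π² lo' κ)`
  have hpt : ∀ᵐ t ∂(volume.restrict (Ioo 0 T)), ∑ k ∈ S, ‖modeRepθ W₁ n 𝔹 G₀ F u k t‖ ^ 2 ≤ Q t / (4 * Real.pi ^ 2 * (lo' * c) * κ) := by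
    filter_upwards [ae_forall_eq_modeRepθ W₁ n hT.le h hFi, hQdom, hterm] with t hrep hQ hk
    have hQS := hQ S
    have hsum : 4 * Real.pi ^ 2 * (lo' * c) * κ * ∑ k ∈ S, ‖modeRepθ W₁ n 𝔹 G₀ F u k t‖ ^ 2 ≤
        4 * Real.pi ^ 2 * ∑ k ∈ S, (⟪mFourierCoeff (EuclideanSpace.complexify ∘ u t) k,
          Torus.symbT (Torus.Visc4.conj G₀ 𝔹) k (mFourierCoeff (EuclideanSpace.complexify ∘ u t) k)⟫_ℂ).re := by
      rw [mul_assoc (4 * Real.pi ^ 2), mul_assoc (4 * Real.pi ^ 2), Finset.mul_sum]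
      refine mul_le_mul_of_nonneg_left (Finset.sum_le_sum fun k hkS => ?_) (by positivity)
      have h1 := (hk k).2
      rw [← hrep k]
      have h2 : lo' * c * κ * ‖mFourierCoeff (EuclideanSpace.complexify ∘ u t) k‖ ^ 2 ≤
          lo' * c * (freqNormSq k * ‖mFourierCoeff (EuclideanSpace.complexify ∘ u t) k‖ ^ 2) := by
        rw [mul_assoc]; exact mul_le_mul_of_nonneg_left (mul_le_mul_of_nonneg_right (hS k hkS) (sq_nonneg _)) hloc.le
      exact h2.trans h1
    rw [le_div_iff₀ (by positivity)]
    linarith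
  -- (3) integrate
  have hcont : ContinuousOn (fun t => ∑ k ∈ S, ‖modeRepθ W₁ n 𝔹 G₀ F u k t‖ ^ 2) (Icc 0 T) :=
    continuousOn_finsetSum S fun k _ => ((continuousOn_modeRepθ W₁ n hT.le h k).norm).pow 2
  have hintL : IntegrableOn (fun t => ∑ k ∈ S, ‖modeRepθ W₁ n 𝔹 G₀ F u k t‖ ^ 2) (Ioo 0 T) volume :=
    (hcont.integrableOn_Icc).mono_set Ioo_subset_Icc_self
  have hintR : IntegrableOn (fun t => Q t / (4 * Real.pi ^ 2 * (lo' * c) * κ)) (Ioo 0 T) volume := hQint.div_const _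
  calc ∫ t in Ioo 0 T, ∑ k ∈ S, ‖modeRepθ W₁ n 𝔹 G₀ F u k t‖ ^ 2
      ≤ ∫ t in Ioo 0 T, Q t / (4 * Real.pi ^ 2 * (lo' * c) * κ) := setIntegral_mono_ae_restrict hintL hintR hpt
    _ = (∫ t in Ioo 0 T, Q t) / (4 * Real.pi ^ 2 * (lo' * c) * κ) := by rw [integral_div]
    _ ≤ ((∫ x, ‖F x‖ ^ 2) / 2) / (4 * Real.pi ^ 2 * (lo' * c) * κ) := by gcongr
    _ = (∫ x, ‖F x‖ ^ 2) / (8 * Real.pi ^ 2 * (lo' * c) * κ) := by field_simp; ring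

end Summit.AnomalousDissipation.AnomalousDissipation.Theorems.SolenoidalFractalHomogenisation.LagrangianStep.CellChain

end
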